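import Summits.ResolutionOfSingularities.ResolutionOfSingularities.Theorems.FrobeniusLadderFInjectiveMacaulayficationFullLastCentreTranslate
import Summits.ResolutionOfSingularities.ResolutionOfSingularities.Theorems.FrobeniusLadderFInjectiveMacaulayficationFullLastCentreEquiChain
import HarnessLib

/-!
# K10j — EQUI-ω CHAINS ARE TAME AT EVERY POINT: the fibre no-rise law and the cap `ρ ≤ 8` at ALL points (chart origins or not) of ω-permissible chains
# (crux `FInjectiveMacaulayfication` stmt-ResolutionOfSingularities-15315, chain w45a; removes the restriction «chart origins only» — gap (g2) of desk ruling R26.40 — from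
# K10g `equiChain_cap`; seat res-L1-w45a-lead-1 g16)

[OURS · L1 W4.5a] Support file (`--supports stmt-ResolutionOfSingularities-15315 --as helper`); replaces the role of NO printed item; NOT a statement of any manuscript;
proves nothing of the crux; OURS counted 0. AI-written (AI review is weaker than expert review).

THE STATEMENTS. (★★ `ordLE_of_equi_fibre`, the FIBRE NO-RISE LAW) Blow up a coordinate centre `Z = V(x, y_Nor)` at a base point where the residual `N` of
`Disc_x P = y^α·N` is ω-permissible (`ρ = ν_Z(N)`); then at EVERY point of the exceptional fibre over the base point (the `y_L`-chart origin translated by `c`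
supported on the fibre letters `Nor ∖ {L}`) every residual decomposition has `ρ″ ≤ ν` — the letter form of «an equimultiple centre does not raise the multiplicity
of the strict transform anywhere on the fibre», for the residual factor of the discriminant. (★ `equiTame_fibre_step`) Hence the invariant `EquiTame` (`ρ ≤ 8` or all
slacks `2d_n − α_n ≤ 0`) of K10g survives «equi-ω step, then pass to any fibre point» (slacks are inherited by K10i `allSlackLE_translate`). (★★★ `equiFibreChain_cap`)
From an exceptional-free germ, along any `EquiFibreReachable` chain, every stage carrying the drop-point budget has `ρ ≤ 8`. Chart-origin chains are the case `c = 0`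
(`equiFibreReachable_of_equiReachable`). WHAT STAYS OPEN: non-ω-permissible steps (LOW-ORDER LEDGER: the same question at origins and at fibre points), non-coordinate
centres (g1), termination of the rule (register ROW #14), the F-side provenance of the budget. Exponent/coefficient bookkeeping only; no named fact.
-/

-- single-problem summit: the doubled namespace component is forced
set_option linter.dupNamespace false

noncomputable section

open MvPolynomial Finsupp
open Summit.ResolutionOfSingularities.ResolutionOfSingularities.Theorems.FInjectiveMacaulayfication.LastCentreDefs
open Summit.ResolutionOfSingularities.ResolutionOfSingularities.Theorems.FInjectiveMacaulayfication.LastCentreAxisOrder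
open Summit.ResolutionOfSingularities.ResolutionOfSingularities.Theorems.FInjectiveMacaulayfication.LastCentreSlack
open Summit.ResolutionOfSingularities.ResolutionOfSingularities.Theorems.FInjectiveMacaulayfication.LastCentreTame


namespace Summit.ResolutionOfSingularities.ResolutionOfSingularities.Theorems.FInjectiveMacaulayfication.LastCentreFibre

open Summit.ResolutionOfSingularities.ResolutionOfSingularities.Theorems.FInjectiveMacaulayfication.LastCentreTranslate
open Summit.ResolutionOfSingularities.ResolutionOfSingularities.Theorems.FInjectiveMacaulayfication.LastCentreEquiChain

variable {k : Type} [Field k]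

/-! ## 1. Exponent plumbing -/

/-- The normal degree is monotone in the set of letters. [plumbing] -/
theorem norDeg_mono_set {T Nor : Finset Letter} (h : T ⊆ Nor) (e : Expo) : norDeg T e ≤ norDeg Nor e :=
  Finset.sum_le_sum_of_subset_of_nonneg h fun _ _ _ => Nat.zero_le _

/-- If `tdeg e = norDeg Nor e`, the exponent `e` vanishes off `Nor`. [plumbing] -/
theorem apply_eq_zero_of_tdeg_eq_norDeg {Nor : Finset Letter} {e : Expo} (h : tdeg e = norDeg Nor e) {m : Letter} (hm : m ∉ Nor) : e m = 0 := by
  classical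
  unfold tdeg norDeg at h
  rw [← Finset.sum_add_sum_compl Nor] at h
  have h0 : ∑ i ∈ Norᶜ, e i = 0 := by omega
  exact (Finset.sum_eq_zero_iff.mp h0) m (Finset.mem_compl.mpr hm)

/-- If `e` vanishes off `Nor`, `tdeg e = norDeg Nor e`. [plumbing] -/
theorem tdeg_eq_norDeg_of_apply_eq_zero {Nor : Finset Letter} {e : Expo} (h : ∀ m, m ∉ Nor → e m = 0) : tdeg e = norDeg Nor e := by
  unfold tdeg norDeg
  exact (Finset.sum_subset (Finset.subset_univ Nor) fun m _ hm => h m hm).symm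

/-- `tdeg (n·ε_L) = n`. [plumbing] -/
theorem tdeg_single (L : Letter) (n : ℕ) : tdeg (Finsupp.single L n) = n := by
  unfold tdeg
  rw [Finset.sum_eq_single L (fun m _ hm => by rw [Finsupp.single_apply, if_neg (Ne.symm hm)]) (by simp)]
  exact Finsupp.single_eq_same

/-- `OrdLE` is monotone in the bound. [plumbing] -/
theorem ordLE_mono {G : YPoly k} {m m' : ℕ} (h : OrdLE G m) (hle : m ≤ m') : OrdLE G m' := by
  obtain ⟨e, he, hd⟩ := h; exact ⟨e, he, hd.trans hle⟩

/-- The chart map kills nothing: `S.D ≠ 0 ⇒ S′.D ≠ 0`. [plumbing] -/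
theorem D_ne_zero_of_chart {S S' : Stage k} {Nor : Finset Letter} {L : Letter} (hch : IsChart S Nor L S') (hD : S.D ≠ 0) : S'.D ≠ 0 := by
  intro h0
  obtain ⟨e, he⟩ := MvPolynomial.ne_zero_iff.mp hD
  have h1 : chartMap Nor L S.D = 0 := by rw [disc_chart hch, h0, mul_zero]
  have := coeff_tau_chartMap Nor L S.D e
  rw [h1, coeff_zero] at this
  exact he this.symm

/-- A stage with a residual decomposition whose residual has a monomial has `D ≠ 0`. [plumbing] -/
theorem D_ne_zero_of_residual {S : Stage k} {α : Expo} {N : YPoly k} (hres : IsResidual S.Exc S.D α N) (hN : N.support.Nonempty) : S.D ≠ 0 := by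
  rw [hres.1]
  refine mul_ne_zero (by rw [Ne, monomial_eq_zero]; exact one_ne_zero) ?_
  obtain ⟨e, he⟩ := hN
  exact MvPolynomial.ne_zero_iff.mpr ⟨e, MvPolynomial.mem_support_iff.mp he⟩

/-! ## 2. The fibre no-rise law -/

/-- ★★ THE FIBRE NO-RISE LAW (equimultiple centres do not raise the residual order at ANY point of the exceptional fibre). Blow up the permissible coordinate centre
`Z = V(x, y_Nor)` at a base point where the residual `N` is ω-PERMISSIBLE (`ρ = ν_Z`: some monomial of `N` has total degree `ν = min norDeg`); let `S′` be the
`y_L`-chart origin and `S″` the stage at the point `y = c` of that chart lying on the fibre over the base point (`c` supported on `Nor ∖ {L}`: the new exceptional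
letter `y_L` and the letters along `Z` stay `0`). Then EVERY residual decomposition at `S″` has `ρ″ ≤ ν`. MECHANISM: the monomials of `N′` in the fibre letters
`T = Nor ∖ {L}` come from the monomials `e` of `N` with `norDeg e = tdeg e = ν` (dehomogenisation in the chart `y_L = 1`), so `keep T N′` is a NON-ZERO polynomial of
total degree `≤ ν` (non-zero by ω-permissibility); `keep T` commutes with the fibre translation, translation preserves total degree, and the unit factor `U` of the
transported residual does not raise orders. [OURS · L1 W4.5a] -/
theorem ordLE_of_equi_fibre {S S' S'' : Stage k} {Nor : Finset Letter} {L : Letter} {α α' α'' : Expo} {N N' N'' : YPoly k} {c : Letter → k}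
    (hL : L ∈ Nor) (hch : IsChart S Nor L S') (hres : IsResidual S.Exc S.D α N) (hres' : IsResidual S'.Exc S'.D α' N')
    {ν : ℕ} (hν₁ : ∃ e ∈ N.support, norDeg Nor e = ν) (hν₂ : ∀ e ∈ N.support, ν ≤ norDeg Nor e) (hequi : ∃ e ∈ N.support, tdeg e = ν)
    (htr : IsTranslate S' c S'') (hc : ∀ m, m ∉ Nor.erase L → c m = 0) (hres'' : IsResidual S''.Exc S''.D α'' N'') :
    OrdLE N'' ν := by
  classical
  set T : Finset Letter := Nor.erase L with hT
  have hTsub : T ⊆ Nor := Finset.erase_subset L Nor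
  have hLT : L ∉ T := Finset.notMem_erase L Nor
  -- (1) every monomial of N′ in the letters of T has degree ≤ ν
  have hdeg : ∀ e' ∈ (keep T N').support, tdeg e' ≤ ν := by
    intro e' he'
    obtain ⟨he'N, hsub⟩ := mem_support_of_keep he'
    obtain ⟨e, he, heq⟩ := (residual_transport hL hch hres hres' hν₁ hν₂ e').mp he'N
    have he'L : e' L = 0 := by
      by_contra hne; exact hLT (hsub (Finsupp.mem_support_iff.mpr hne))
    -- norDeg Nor e = ν (compare the L-exponents) and e vanishes off Nor (compare the other exponents)
    have hnor : norDeg Nor e = ν := by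
      have := congrArg (fun f => f L) heq
      simp only [Finsupp.coe_add, Pi.add_apply, Finsupp.single_eq_same, he'L, zero_add, tau_apply_self Nor L e hL] at this
      exact this.symm
    have hoff : ∀ m, m ∉ Nor → e m = 0 := by
      intro m hm
      have hmL : m ≠ L := fun h => hm (h ▸ hL)
      have hmT : m ∉ T := fun h => hm (hTsub h)
      have h1 := congrArg (fun f => f m) heq
      simp only [Finsupp.coe_add, Pi.add_apply, Finsupp.single_apply, if_neg (Ne.symm hmL), add_zero,
        tau_apply_ne Nor L e hmL] at h1
      have h2 : e' m = 0 := by by_contra hne; exact hmT (hsub (Finsupp.mem_support_iff.mpr hne))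
      rw [← h1, h2]
    have htd : tdeg e = ν := by rw [tdeg_eq_norDeg_of_apply_eq_zero hoff, hnor]
    -- degrees: tdeg e′ + ν = tdeg (τ e) = tdeg e + norDeg T e ≤ ν + ν
    have h3 : tdeg e' + ν = tdeg e + norDeg T e := by
      have := congrArg tdeg heq
      rw [tdeg_add, tdeg_tau, tdeg_single] at this
      exact this
    have h4 : norDeg T e ≤ ν := (norDeg_mono_set hTsub e).trans hnor.le
    omega
  -- (2) there is such a monomial: the ω-permissible witness e⋆ of N (tdeg e⋆ = ν) gives τ e⋆ − ν ε_L, a monomial of N′ in the letters of T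
  have hne : keep T N' ≠ 0 := by
    obtain ⟨e₀, he₀, hρ⟩ := hequi
    have hnor₀ : norDeg Nor e₀ = ν := le_antisymm (hρ ▸ norDeg_le_tdeg Nor e₀) (hν₂ e₀ he₀)
    have hoff₀ : ∀ m, m ∉ Nor → e₀ m = 0 := fun m hm => apply_eq_zero_of_tdeg_eq_norDeg (hρ.trans hnor₀.symm) hm
    have hle : Finsupp.single L ν ≤ tau Nor L e₀ := by
      intro m
      by_cases hm : m = L
      · subst hm; rw [Finsupp.single_eq_same, tau_apply_self Nor _ e₀ hL, hnor₀]
      · rw [Finsupp.single_apply, if_neg (Ne.symm hm)]; exact Nat.zero_le _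
    have hmem : tau Nor L e₀ - Finsupp.single L ν ∈ N'.support :=
      (residual_transport hL hch hres hres' hν₁ hν₂ _).mpr ⟨e₀, he₀, tsub_add_cancel_of_le hle⟩
    refine keep_ne_zero hmem fun m hm => ?_
    rw [Finsupp.mem_support_iff, Finsupp.tsub_apply] at hm
    rw [hT, Finset.mem_erase]
    refine ⟨fun hmL => ?_, ?_⟩
    · subst hmL; rw [tau_apply_self Nor _ e₀ hL, hnor₀, Finsupp.single_eq_same, Nat.sub_self] at hm; exact hm rfl
    · by_contra hmN
      have hmL : m ≠ L := fun h => hmN (h ▸ hL)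
      rw [tau_apply_ne Nor L e₀ hmL, hoff₀ m hmN, Finsupp.single_apply, if_neg (Ne.symm hmL)] at hm
      exact hm rfl
  -- (3) the residual at S″ is U · translate c N′
  obtain ⟨hD'', hExc'', -⟩ := htr
  obtain ⟨α₁, U, hres₁, -, -, hU0, hkeepU⟩ := isResidual_translate c hres' hExc''
  rw [← hD''] at hres₁
  obtain ⟨-, hNeq⟩ := residual_unique hres₁ hres''
  rw [← hNeq]
  -- (4) orders: keep T (U · translate N′) = U · translate (keep T N′) has order ≤ ν, hence so has U · translate N′
  have hc' : ∀ m, m ∉ T → c m = 0 := fun m hm => hc m (by rwa [hT] at hm)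
  have hK : OrdLE (keep T (U * translate c N')) ν := by
    rw [map_mul, hkeepU T hc', keep_translate T c hc']
    exact ordLE_unit_mul hU0 (ordLE_translate_of_totalDegree_le hne (totalDegree_le_of_forall hdeg) c)
  obtain ⟨e, he, hd⟩ := hK
  exact ⟨e, (mem_support_of_keep he).1, hd⟩

/-! ## 3. Equi-ω chains through arbitrary fibre points -/

/-- The zero translation is the identity step. [plumbing] -/
theorem translate_zero (G : YPoly k) : LastCentreTranslate.translate (fun _ => (0 : k)) G = G := by
  have h : LastCentreTranslate.translate (fun _ => (0 : k)) = AlgHom.id k (YPoly k) := by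
    apply algHom_ext; intro m
    rw [translate_X, C_0, add_zero, AlgHom.id_apply]
  rw [h, AlgHom.id_apply]

/-- The chart origin itself is the fibre point `c = 0`. [plumbing] -/
theorem isTranslate_zero (S : Stage k) : IsTranslate S (fun _ => (0 : k)) S :=
  ⟨(translate_zero S.D).symm, fun n => by simp, fun _ _ => rfl⟩

/-- EQUI-ω FIBRE CHAINS: chains of blow-ups of coordinate centres `Z = V(x, y_Nor)` (any dimension), each ω-permissible at its base point (`ρ = ν_Z`), followed at
every step by the passage to an ARBITRARY point of the exceptional fibre over the base point (`c` supported on `Nor ∖ {L}`; `c = 0` is the chart origin). This is the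
local history of every point of a resolution tree all of whose centres are ω-permissible coordinate centres along the image points (points over other points of the
centre are reached by starting the chain at that image point: `S₀` is any exceptional-free germ). [OURS · L1 W4.5a · definition] -/
inductive EquiFibreReachable (S₀ : Stage k) : Stage k → Prop
  | refl : EquiFibreReachable S₀ S₀
  | step {S S' S'' : Stage k} (Nor : Finset Letter) (L : Letter) (α : Expo) (N : YPoly k) (ν : ℕ) (c : Letter → k) :
      EquiFibreReachable S₀ S → L ∈ Nor → IsChart S Nor L S' → IsResidual S.Exc S.D α N →
      (∃ e ∈ N.support, norDeg Nor e = ν) → (∀ e ∈ N.support, ν ≤ norDeg Nor e) → (∃ e ∈ N.support, tdeg e = ν) →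
      IsTranslate S' c S'' → (∀ m, m ∉ Nor.erase L → c m = 0) → EquiFibreReachable S₀ S''

/-- Chart-origin equi-ω chains (K10g `EquiReachable`) are fibre chains. [plumbing] -/
theorem equiFibreReachable_of_equiReachable {S₀ S : Stage k} (h : EquiReachable S₀ S) : EquiFibreReachable S₀ S := by
  induction h with
  | refl => exact EquiFibreReachable.refl
  | @step S S' Nor L α N ν _ hL hch hres hν₁ hν₂ hequi ih =>
    exact EquiFibreReachable.step Nor L α N ν (fun _ => 0) ih hL hch hres hν₁ hν₂ hequi (isTranslate_zero S') (fun _ _ => rfl)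

/-- ★ THE INVARIANT `EquiTame` (`ρ ≤ 8` or all slacks non-positive) SURVIVES AN EQUI-ω STEP FOLLOWED BY THE PASSAGE TO ANY FIBRE POINT. [OURS · L1 W4.5a] -/
theorem equiTame_fibre_step {S S' S'' : Stage k} {Nor : Finset Letter} {L : Letter} {α α'' : Expo} {N N'' : YPoly k} {c : Letter → k}
    (hL : L ∈ Nor) (hch : IsChart S Nor L S') (hres : IsResidual S.Exc S.D α N)
    {ν : ℕ} (hν₁ : ∃ e ∈ N.support, norDeg Nor e = ν) (hν₂ : ∀ e ∈ N.support, ν ≤ norDeg Nor e) (hequi : ∃ e ∈ N.support, tdeg e = ν)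
    (htr : IsTranslate S' c S'') (hc : ∀ m, m ∉ Nor.erase L → c m = 0) (hres'' : IsResidual S''.Exc S''.D α'' N'')
    (hT : EquiTame S α N) : EquiTame S'' α'' N'' := by
  -- a residual decomposition at the intermediate chart origin
  have hD' : S'.D ≠ 0 := D_ne_zero_of_chart hch (D_ne_zero_of_residual hres (by obtain ⟨e, he, -⟩ := hν₁; exact ⟨e, he⟩))
  obtain ⟨α', N', hres'⟩ := LastCentreResidual.exists_isResidual S'.Exc S'.D hD'
  by_cases h8 : ν ≤ 8
  · left
    exact ordLE_mono (ordLE_of_equi_fibre hL hch hres hres' hν₁ hν₂ hequi htr hc hres'') h8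
  rcases hT with hle | hslack
  · exfalso
    obtain ⟨e, he, hd⟩ := hle
    have := hν₂ e he
    have := norDeg_le_tdeg Nor e
    omega
  · right
    have hcard : 2 * Nor.card ≤ ν := by
      have : Nor.card ≤ 4 := by simpa using Finset.card_le_univ Nor
      omega
    exact allSlackLE_translate htr hres' (allSlackLE_step hL hch hres hres' hν₁ hν₂ hcard hslack) hres''

/-- Along an equi-ω fibre chain from an exceptional-free germ every residual decomposition of every stage is `EquiTame`. [OURS · plumbing] -/
theorem equiTame_of_equiFibreReachable {S₀ S : Stage k} (hExc : S₀.Exc = ∅) (h : EquiFibreReachable S₀ S)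
    {α : Expo} {N : YPoly k} (hres : IsResidual S.Exc S.D α N) : EquiTame S α N := by
  induction h generalizing α N with
  | refl => right; intro n hn; rw [hExc] at hn; exact absurd hn (Finset.notMem_empty n)
  | @step S S' S'' Nor L α₀ N₀ ν c _ hL hch hres₀ hν₁ hν₂ hequi htr hc ih =>
    exact equiTame_fibre_step hL hch hres₀ hν₁ hν₂ hequi htr hc hres (ih hres₀)

/-- ★★★ EQUI-ω CHAINS ARE TAME AT EVERY POINT (typed MC-8ᶜ at all points — chart origins or not — for ω-permissible rules with coordinate centres). From an
exceptional-free germ `S₀`, along any chain of ω-permissible blow-ups each followed by the passage to an arbitrary point of the exceptional fibre, at every stage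
carrying the drop-point budget `∃` monomial of `Disc` of degree `≤ 8 + 2·Σ_{E∋pt} d_E`, EVERY residual decomposition has `ρ ≤ 8`. This removes the restriction
«chart origins only» (gap (g2) of desk ruling R26.40) from K10g `equiChain_cap` for equi-ω rules; for NON-equi-ω steps the fibre question stays open exactly where the
origin question is (LOW-ORDER LEDGER). [OURS · L1 W4.5a] -/
theorem equiFibreChain_cap {S₀ S : Stage k} (hExc : S₀.Exc = ∅) (hreach : EquiFibreReachable S₀ S) (hbud : DropBudget S)
    {α : Expo} {N : YPoly k} (hres : IsResidual S.Exc S.D α N) : OrdLE N 8 := by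
  rcases equiTame_of_equiFibreReachable hExc hreach hres with hle | hslack
  · exact hle
  · exact ordLE_eight_of_allSlackLE_dropBudget hres hslack hbud

end Summit.ResolutionOfSingularities.ResolutionOfSingularities.Theorems.FInjectiveMacaulayfication.LastCentreFibre

end
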